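import Mathlib.RingTheory.Ideal.Height
import Mathlib.RingTheory.MvPolynomial.EulerIdentity
import Mathlib.Algebra.MvPolynomial.Rename
import Mathlib.Logic.Equiv.Fin.Basic
import Literature.Computability.AlgebraicComplexity.StandardFamilies
import Literature.Computability.AlgebraicComplexity.VonZurGathenRegularity
import Literature.Computability.AlgebraicComplexity.AlperBogartVelascoProofs
import Literature.Computability.AlgebraicComplexity.ABV17Thm17BertiniProofs

/-!
# Cone sections of `Sing(per₄)` — the W-independent reduction

`codim Sing(per₄) ≥ 7` (i.e. `7 ≤ height (singPermIdeal ℂ 4)`, the exact input of the (4,2) lower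
rung `StrengthTwoPerFourGeFour` of line `laplace_rigidity`, crux `CoverDecancellation`) is reduced to a
POINT-SET statement about one linear section: if `G` is any set of at most nine polynomials without
constant term such that the only `4 × 4` complex matrix all of whose sixteen `3 × 3` sub-permanents
vanish and which is killed by `G` is the zero matrix, then `7 ≤ height (singPermIdeal ℂ 4)`.

The commutative algebra (catenary dimension formula, Krull's height theorem, homogeneity of minimal
primes, Nullstellensatz) is entirely the tree's cone-section lemma
`ABV17Bertini.natCast_le_height_span_add_card` (Hartshorne I Thm 7.2), transported along
`Fin 4 × Fin 4 ≃ Fin 16`; what is left to whoever closes the rung is the point-set lemma for ONE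
explicit section (by a Nullstellensatz certificate, or by the zero-pattern classification of
`Sing(per₄)`).

No `sorry`; no new definitions.
-/

namespace Summit.ValiantsHypothesis.ValiantsHypothesis.Cruxes.CoverDecancellation.SingPerFourSection

open MvPolynomial
open Literature.Computability.AlgebraicComplexity

/-- The generating set of `singPermIdeal K m`: `per_m` and its `m²` partials. -/
theorem singPermIdeal_eq_span (K : Type*) [CommRing K] (m : ℕ) :
    VonZurGathen.singPermIdeal K m =
      Ideal.span (insert (perPoly (Fin m) K)
        (Set.range fun ij : Fin m × Fin m => pderiv ij (perPoly (Fin m) K))) := rfl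

/-- Every generator of `singPermIdeal` is homogeneous. -/
theorem singPermIdeal_generators_isHomogeneous (K : Type*) [CommRing K] (m : ℕ) :
    ∀ p ∈ insert (perPoly (Fin m) K)
        (Set.range fun ij : Fin m × Fin m => pderiv ij (perPoly (Fin m) K)),
      ∃ d, p.IsHomogeneous d := by
  intro p hp
  rcases Set.mem_insert_iff.1 hp with rfl | ⟨ij, rfl⟩
  · exact ⟨_, perPoly_isHomogeneous⟩
  · exact ⟨_, (perPoly_isHomogeneous (n := Fin m) (k := K)).pderiv⟩

/-- **Cone-section reduction for `Sing(per₄)`** (any size `m+1`, any number of cutting polynomials).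
If `G` consists of polynomials without constant term and the only point of `K^{(m+1)×(m+1)}` at which
all `(m+1)²` maximal sub-permanents and all members of `G` vanish is the origin, then
`(m+1)² ≤ height (singPermIdeal K (m+1)) + #G`. -/
theorem sq_le_height_singPermIdeal_add_card {K : Type} [Field K] [IsAlgClosed K] {m : ℕ}
    (G : Finset (MvPolynomial (Fin (m + 1) × Fin (m + 1)) K))
    (hG : ∀ g ∈ G, constantCoeff g = 0)
    (h0 : ∀ x : Fin (m + 1) × Fin (m + 1) → K,
      (∀ r c : Fin (m + 1),
        ((Matrix.of fun i j => x (i, j)).submatrix r.succAbove c.succAbove).permanent = 0) →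
      (∀ g ∈ G, eval x g = 0) → x = 0) :
    (((m + 1) * (m + 1) : ℕ) : ℕ∞) ≤
      (VonZurGathen.singPermIdeal K (m + 1)).height + G.card := by
  classical
  -- transport along `e : Fin (m+1) × Fin (m+1) ≃ Fin ((m+1)*(m+1))`
  set e : Fin (m + 1) × Fin (m + 1) ≃ Fin ((m + 1) * (m + 1)) := finProdFinEquiv with he
  set φ : MvPolynomial (Fin (m + 1) × Fin (m + 1)) K ≃ₐ[K] MvPolynomial (Fin ((m + 1) * (m + 1))) K :=
    renameEquiv K e with hφ
  set S : Set (MvPolynomial (Fin (m + 1) × Fin (m + 1)) K) :=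
    insert (perPoly (Fin (m + 1)) K)
      (Set.range fun ij : Fin (m + 1) × Fin (m + 1) => pderiv ij (perPoly (Fin (m + 1)) K)) with hSdef
  set S' : Set (MvPolynomial (Fin ((m + 1) * (m + 1))) K) := (fun p => rename e p) '' S with hS'
  set G' : Finset (MvPolynomial (Fin ((m + 1) * (m + 1))) K) := G.image (fun p => rename e p) with hG'
  -- homogeneity of the transported generators
  have hS'hom : ∀ p ∈ S', ∃ d, p.IsHomogeneous d := by
    rintro p ⟨q, hq, rfl⟩
    obtain ⟨d, hd⟩ := singPermIdeal_generators_isHomogeneous K (m + 1) q hq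
    exact ⟨d, hd.rename_isHomogeneous⟩
  -- no constant terms
  have hG'c : ∀ g ∈ G', constantCoeff g = 0 := by
    intro g hg
    obtain ⟨q, hq, rfl⟩ := Finset.mem_image.1 hg
    rw [constantCoeff_rename]
    exact hG q hq
  -- the point condition, pulled back along `e`
  have h0' : ∀ x' : Fin ((m + 1) * (m + 1)) → K,
      (∀ p ∈ S', eval x' p = 0) → (∀ g ∈ G', eval x' g = 0) → x' = 0 := by
    intro x' hS hGx
    have hx : (x' ∘ e) = 0 := by
      refine h0 (x' ∘ e) (fun r c => ?_) (fun g hg => ?_)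
      · have h1 := hS (rename e (pderiv (r, c) (perPoly (Fin (m + 1)) K)))
          ⟨_, Set.mem_insert_of_mem _ ⟨(r, c), rfl⟩, rfl⟩
        rw [eval_rename] at h1
        rwa [AlperBogartVelasco.eval_pderiv_perPoly_eq_permanent_submatrix] at h1
      · have h1 := hGx (rename e g) (Finset.mem_image_of_mem _ hg)
        rwa [eval_rename] at h1
    funext k
    have := congrFun hx (e.symm k)
    simpa using this
  have key := ABV17Bertini.natCast_le_height_span_add_card S' hS'hom G' hG'c h0'
  -- `span S' = map φ (singPermIdeal)`, same height
  have himg : S' = (φ.toRingEquiv : MvPolynomial (Fin (m + 1) × Fin (m + 1)) K →+*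
      MvPolynomial (Fin ((m + 1) * (m + 1))) K) '' S := by
    rw [hS']
    exact Set.image_congr fun p _ => rfl
  have hmap : Ideal.span S' = (VonZurGathen.singPermIdeal K (m + 1)).map
      (φ.toRingEquiv : MvPolynomial (Fin (m + 1) × Fin (m + 1)) K →+*
        MvPolynomial (Fin ((m + 1) * (m + 1))) K) := by
    rw [singPermIdeal_eq_span, Ideal.map_span, himg]
  have hht : (Ideal.span S').height = (VonZurGathen.singPermIdeal K (m + 1)).height := by
    rw [hmap, Ideal.map_comap_of_equiv]
    exact RingEquiv.height_comap _ _
  have hcard : (G'.card : ℕ∞) ≤ G.card := by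
    exact_mod_cast Finset.card_image_le
  calc (((m + 1) * (m + 1) : ℕ) : ℕ∞) ≤ (Ideal.span S').height + G'.card := key
    _ ≤ (VonZurGathen.singPermIdeal K (m + 1)).height + G.card := by
        rw [hht]; exact add_le_add le_rfl hcard

/-- **The rung's input, section form.** If nine polynomials without constant term cut the cone
`Sing(per₄) = V(per₄, ∂per₄)` down to the origin (as a point set over `ℂ`), then
`codim Sing(per₄) ≥ 7`, i.e. `7 ≤ height (singPermIdeal ℂ 4)`. -/
theorem seven_le_height_singPermIdeal_four_of_section
    (G : Finset (MvPolynomial (Fin 4 × Fin 4) ℂ)) (hcard : G.card ≤ 9)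
    (hG : ∀ g ∈ G, constantCoeff g = 0)
    (h0 : ∀ x : Fin 4 × Fin 4 → ℂ,
      (∀ r c : Fin 4,
        ((Matrix.of fun i j => x (i, j)).submatrix r.succAbove c.succAbove).permanent = 0) →
      (∀ g ∈ G, eval x g = 0) → x = 0) :
    (7 : ℕ∞) ≤ (VonZurGathen.singPermIdeal ℂ 4).height := by
  have key : (16 : ℕ∞) ≤ (VonZurGathen.singPermIdeal ℂ 4).height + G.card := by
    simpa using sq_le_height_singPermIdeal_add_card (m := 3) G hG h0
  have hc : (G.card : ℕ∞) ≤ 9 := by exact_mod_cast hcard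
  -- 16 ≤ h + #G ≤ h + 9
  have h2 : (16 : ℕ∞) ≤ (VonZurGathen.singPermIdeal ℂ 4).height + 9 :=
    key.trans (add_le_add le_rfl hc)
  cases hh : (VonZurGathen.singPermIdeal ℂ 4).height with
  | top => exact le_top
  | coe n =>
      rw [hh] at h2
      have : (16 : ℕ) ≤ n + 9 := by exact_mod_cast h2
      exact_mod_cast (by omega : 7 ≤ n)

end Summit.ValiantsHypothesis.ValiantsHypothesis.Cruxes.CoverDecancellation.SingPerFourSection
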